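import Literature.Computability.Complexity.Iterate
import Literature.Computability.Complexity.Quotient
import Literature.Computability.Complexity.ExpanderFamily
import HarnessLib

/-!
# Dinur's theorem with explicit expanders: the parameters of the round, instantiated (Arora–Barak, Thm. 11.5 via Lemma 22.4)

`Round.lean` proves the PCP Main Lemma (Arora–Barak 2009, Lemma 22.4) for any `P : RoundParams`
satisfying `P.Good` (cloud edge-expanders, `1/10`-spectral expanders of every padded size, `t` large);
`Iterate.lean` iterates it into the combinatorial Dinur theorem.  This file discharges the hypotheses
from an **expander kit** (`Kit`: a dense family of `1/10`-spectral expanders plus cloud edge-expanders of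
every size) by choosing the powering parameter `t = (4 W M)²` (`mkParams`, `mkParams_good`), and
provides the kit of `ExpanderFamily.lean` (zig-zag recursion on the affine-plane base graph — in place
of the brute-force base graphs of Arora–Barak Thm. 21.19; clouds by contraction, `Quotient.lean`):

* `Kit`, `mkParams K : RoundParams`, **`mkParams_good : (mkParams K).Good`**;
* `Family.X k` (`d₀ = 2B · D²`, contracting `Family.G (log_B (2k))`), `Family.edgeExpansion_X`, `zigzagKit`;
* `instP := mkParams zigzagKit` and **`dinur_isExactWidth`, `dinur_satisfiable`, `dinur_maxSatFraction_le`,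
  `dinur_length_le`** — for every CNF `φ` of width `≤ 3`: `dinur instP φ` is an E3-CNF, satisfiable if `φ`
  is, of value `≤ 1 - ε₁` (an absolute constant `ε₁ > 0`) if `φ` is not, and with at most
  `C^{log₂ m + 1} · m · c` clauses ("Theorem 11.5 from Lemma 22.4", at the level of formulas;
  polynomial-time computability of the map is the remaining, machine-level, part of the PCP theorem).

## References

* S. Arora, B. Barak, *Computational Complexity: A Modern Approach*, CUP 2009, §22.2 (proof of Thm. 11.5
  from Lemma 22.4), Lemma 22.4, Thm. 21.19.
* I. Dinur, *The PCP theorem by gap amplification*, J. ACM 54 (2007), Thm. 1.2.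
-/

noncomputable section

set_option exponentiation.threshold 4096

namespace Literature.Computability.Complexity

open Finset

namespace Expander

open BLR.Table RoundParams

/-! ### Expander kits and the generic instantiation -/

/-- An **expander kit**: cloud edge-expanders `X k` of every size with a fixed degree, and a dense family of
`1/10`-spectral expanders `XN n` on `Nx n ∈ [n, cN n]` vertices. [cite: AroraBarakCC2009, §22.A (the expanders assumed by Claims 22.37–22.38)] -/
structure Kit where
  /-- degree of the cloud expanders -/
  d₀ : ℕ
  /-- positivity of the cloud degree -/
  d₀_pos : 0 < d₀
  /-- the cloud expanders -/
  X : (k : ℕ) → RotGraph k d₀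
  /-- their edge expansion -/
  η : ℝ
  /-- positivity of the edge expansion -/
  η_pos : 0 < η
  /-- the edge expansion inequality -/
  edgeExp : ∀ (k : ℕ) (Q : Finset (Fin k)), 2 * Q.card ≤ k →
    η * Q.card ≤ ((univ.filter fun x : Fin k × Fin d₀ => x.1 ∈ Q ∧ (X k).nbr x.1 x.2 ∉ Q).card : ℝ)
  /-- degree of the vertex-set expanders -/
  dX : ℕ
  /-- positivity of the degree -/
  dX_pos : 0 < dX
  /-- the padded size -/
  Nx : ℕ → ℕ
  /-- padding does not shrink -/
  Nx_ge : ∀ n, n ≤ Nx n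
  /-- padding ratio -/
  cN : ℝ
  /-- positivity of the padding ratio -/
  cN_pos : 0 < cN
  /-- linear padding -/
  Nx_le : ∀ n, 0 < n → (Nx n : ℝ) ≤ cN * n
  /-- the vertex-set expanders -/
  XN : (n : ℕ) → RotGraph (Nx n) dX
  /-- their spectral bound -/
  spectral : ∀ n, SpectralBound (XN n).walkMatrix (1 / 10)

namespace Kit

variable (K : Kit)

/-- The lazy degree `D` of the round built on `K`, as a number. [folklore] -/
def Dnat : ℕ := (K.d₀ + 1 + K.dX * (K.d₀ + 1)) + (K.d₀ + 1 + K.dX * (K.d₀ + 1))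

/-- The constant `q₀ (2 d₁) cN (2 (1 + dX))` of `Good.big`. [folklore] -/
def Kc : ℝ := (q₀ : ℝ) * (2 * ((K.d₀ + 1 : ℕ) : ℝ)) * K.cN * (2 * (1 + (K.dX : ℝ)))

/-- The window size `M = ⌈64 W⁴ (2 + 18 D) Kc / min(2, η)⌉ + 1`. [cite: AroraBarakCC2009, Lemma 22.5 (t large enough)] -/
def Mbig : ℕ := ⌈64 * (W : ℝ) ^ 4 * (2 + 18 * (K.Dnat : ℝ)) * K.Kc / min 2 K.η⌉₊ + 1

/-- The powering parameter `t = (4 W M)²`. [cite: AroraBarakCC2009, Lemma 22.5] -/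
def tP : ℕ := (4 * W * K.Mbig) ^ 2

/-- **The round parameters built on the kit.** [cite: AroraBarakCC2009, Lemma 22.4] -/
def mkParams : RoundParams := ⟨K.d₀, K.X, K.dX, K.Nx, K.Nx_ge, K.XN, K.tP, K.η, K.cN⟩

/-- `(mkParams K).D = Dnat`. [folklore] -/
theorem mkParams_D : K.mkParams.D = K.Dnat := rfl

/-- `(mkParams K).mw = M`. [folklore] -/
theorem mkParams_mw : K.mkParams.mw = K.Mbig := by
  show Nat.sqrt K.tP / (4 * W) = K.Mbig
  rw [tP, Nat.sqrt_eq', Nat.mul_div_cancel_left _ (Nat.mul_pos (by norm_num) W_pos)]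

/-- **The parameters built on a kit are good.** [cite: AroraBarakCC2009, Lemma 22.4 (the constants exist)] -/
theorem mkParams_good : K.mkParams.Good where
  d₀_pos := K.d₀_pos
  dX_pos := K.dX_pos
  η_pos := K.η_pos
  edgeExp := K.edgeExp
  spectral := K.spectral
  cN_pos := K.cN_pos
  Nx_le := K.Nx_le
  mw_pos := by rw [mkParams_mw, Mbig]; exact Nat.le_add_left 1 _
  big := by
    rw [mkParams_mw]
    have hη : 0 < min 2 K.η := lt_min two_pos K.η_pos
    have hX : 64 * (W : ℝ) ^ 4 * (2 + 18 * (K.mkParams.D : ℝ)) * ((q₀ : ℝ) * (2 * K.mkParams.d₁) * K.mkParams.cN * (2 * (1 + K.mkParams.dX))) =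
        64 * (W : ℝ) ^ 4 * (2 + 18 * (K.Dnat : ℝ)) * K.Kc := by
      rw [mkParams_D]; rfl
    rw [hX]
    set X := 64 * (W : ℝ) ^ 4 * (2 + 18 * (K.Dnat : ℝ)) * K.Kc
    have hM : X / min 2 K.η ≤ K.Mbig := by
      rw [Mbig]; push_cast
      exact (Nat.le_ceil _).trans (le_add_of_nonneg_right zero_le_one)
    show X ≤ (K.Mbig : ℝ) * min 2 K.mkParams.η
    have : K.mkParams.η = K.η := rfl
    rw [this]
    rw [div_le_iff₀ hη] at hM
    exact hM

end Kit

/-! ### The cloud expanders from the zig-zag family -/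

namespace Family

open RotGraph

/-- The number of label blocks `C = 2B`. [folklore] -/
def Cq : ℕ := 2 * B

/-- The degree `d₀ = C · D²` of the cloud expanders. [folklore] -/
def d₀ : ℕ := Cq * (D * D)

/-- `d₀ > 0`. [folklore] -/
theorem d₀_pos : 0 < d₀ := by unfold d₀ Cq; have := two_le_B; have := D_pos; positivity

/-- The member contracted for `k` vertices has `Nx (2k) ≤ 2B k` vertices. [folklore] -/
theorem Nx_two_mul_le {k : ℕ} (hk : 0 < k) : Nx (2 * k) ≤ Cq * k :=
  calc Nx (2 * k) ≤ B * (2 * k) := Nx_le (n := 2 * k) (by omega)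
    _ = Cq * k := by rw [Cq]; ring

/-- **The cloud expanders `X k`**: the contraction of `G (log_B (2k))` onto `k` vertices. [cite: AroraBarakCC2009, Thm. 21.19 and Claim 22.37 (a d-regular expander on each cloud)] -/
def X (k : ℕ) : RotGraph k d₀ := quot (G (idx (2 * k))) k Cq fun hk => Nx_two_mul_le hk

/-- The edge-expansion constant `η = D² (1 - 2/5)/2`. [folklore] -/
def η : ℝ := (D * D : ℕ) * (1 - 2 / 5) / 2

/-- `η > 0`. [folklore] -/
theorem η_pos : 0 < η := by unfold η; have := Nat.mul_pos D_pos D_pos; positivity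

/-- **Edge expansion of the cloud expanders**: `η |Q| ≤ #{darts leaving Q}` for `2|Q| ≤ k`.
[cite: AroraBarakCC2009, Exercise 21.16 and Claim 22.37] -/
theorem edgeExpansion_X (k : ℕ) (Q : Finset (Fin k)) (hQ : 2 * Q.card ≤ k) :
    η * Q.card ≤ ((univ.filter fun x : Fin k × Fin d₀ => x.1 ∈ Q ∧ (X k).nbr x.1 x.2 ∉ Q).card : ℝ) :=
  edgeExpansion_quot (G (idx (2 * k))) k Cq (fun hk => Nx_two_mul_le hk) (Nat.mul_pos D_pos D_pos)
    (spectralBound_G _) (by norm_num) (le_Nx (2 * k)) Q hQ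

/-- **The zig-zag kit.** [cite: ReingoldVadhanWigderson2002, Thm. 3.3; AroraBarakCC2009, Thm. 21.19] -/
def zigzagKit : Kit where
  d₀ := d₀
  d₀_pos := d₀_pos
  X := X
  η := η
  η_pos := η_pos
  edgeExp := edgeExpansion_X
  dX := dX
  dX_pos := dX_pos
  Nx := Nx
  Nx_ge := le_Nx
  cN := (B : ℝ)
  cN_pos := by exact_mod_cast lt_of_lt_of_le two_pos two_le_B
  Nx_le := fun n hn => by exact_mod_cast Nx_le hn
  XN := XN
  spectral := spectralBound_XN

end Family

/-! ### Dinur's theorem, combinatorial form, with explicit parameters -/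

namespace RoundParams

/-- **The instantiated round parameters** (zig-zag kit). [cite: AroraBarakCC2009, Lemma 22.4] -/
def instP : RoundParams := Family.zigzagKit.mkParams

/-- The instantiated parameters are good. [cite: AroraBarakCC2009, Lemma 22.4] -/
theorem instP_good : instP.Good := Family.zigzagKit.mkParams_good

/-- The gap constant `ε₁ > 0`. [folklore] -/
theorem ε₁_instP_pos : 0 < instP.ε₁ := instP.ε₁_pos

/-- The output is an E3-CNF. [cite: AroraBarakCC2009, §22.4] -/
theorem dinur_isExactWidth (φ : CNF ℕ) : (instP.dinur φ).IsExactWidth 3 := instP.isExactWidth_dinur φ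

/-- **Completeness.** [cite: AroraBarakCC2009, §22.2 (proof of Thm. 11.5)] -/
theorem dinur_satisfiable {φ : CNF ℕ} (hw : φ.IsWidthLE 3) (h : φ.Satisfiable) : (instP.dinur φ).Satisfiable :=
  instP.satisfiable_dinur hw h

/-- **Soundness**: an unsatisfiable 3CNF maps to an E3-CNF of value `≤ 1 - ε₁`. [cite: AroraBarakCC2009, §22.2 (proof of Thm. 11.5)] -/
theorem dinur_maxSatFraction_le {φ : CNF ℕ} (hw : φ.IsWidthLE 3) (h : ¬ φ.Satisfiable) :
    ((instP.dinur φ).maxSatFraction : ℝ) ≤ 1 - instP.ε₁ :=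
  instP.maxSatFraction_dinur_le instP_good hw h

/-- **Size**: at most `roundC^{log₂ m + 1} · m · 2^{q₀} (q₀ + 4)` clauses. [cite: AroraBarakCC2009, §22.2 ("C^{log m} m")] -/
theorem dinur_length_le (φ : CNF ℕ) :
    ((instP.dinur φ).length : ℝ) ≤ instP.roundC ^ (Nat.log 2 φ.length + 1) * φ.length * (2 ^ q₀ * (q₀ + 4)) :=
  instP.length_dinur_le instP_good φ

end RoundParams

end Expander

end Literature.Computability.Complexity

end
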